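import Literature.MathematicalPhysics.QuantumFieldTheory.ConformalBootstrap3D.PointKernelK34v2Data

/-!
# K34v2 certificate, kernel block file H12: head segments `218 ≤ i < 223` (block-checked ones)

`decide` by kernel reduction (no `native_decide`, no extra axioms) of the block checker
`PCert.hBlockOK` of `PointKernel` on the literal data of `PointKernelK34v2Data` (cells checked corner
or chord by the rule bit); soundness is `PCert.hBlockOK_sound`.  Estimated kernel time 224 s
(5 theorems).
-/

set_option maxRecDepth 100000
set_option maxHeartbeats 0

namespace Literature.MathematicalPhysics.QuantumFieldTheory.ConformalBootstrap3D.PointKernelK34v2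

open Literature.MathematicalPhysics.QuantumFieldTheory.ConformalBootstrap3D.PointKernel

/-- head segment `[218, 219)` passes the kernel evaluator (≈41 s of kernel work). [folklore] -/
theorem hBlock_218 : certK34v2.hBlockOK hsegsK34v2 218 219 JHK34v2 = true := by
  decide +kernel

/-- head segment `[219, 220)` passes the kernel evaluator (≈41 s of kernel work). [folklore] -/
theorem hBlock_219 : certK34v2.hBlockOK hsegsK34v2 219 220 JHK34v2 = true := by
  decide +kernel

/-- head segment `[220, 221)` passes the kernel evaluator (≈41 s of kernel work). [folklore] -/
theorem hBlock_220 : certK34v2.hBlockOK hsegsK34v2 220 221 JHK34v2 = true := by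
  decide +kernel

/-- head segment `[221, 222)` passes the kernel evaluator (≈41 s of kernel work). [folklore] -/
theorem hBlock_221 : certK34v2.hBlockOK hsegsK34v2 221 222 JHK34v2 = true := by
  decide +kernel

/-- head segment `[222, 223)` passes the kernel evaluator (≈41 s of kernel work). [folklore] -/
theorem hBlock_222 : certK34v2.hBlockOK hsegsK34v2 222 223 JHK34v2 = true := by
  decide +kernel

end Literature.MathematicalPhysics.QuantumFieldTheory.ConformalBootstrap3D.PointKernelK34v2
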